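import Literature.AlgebraicGeometry.ModuliOfAbelianVarieties.SiegelCMSpecialPairConjugate
import HarnessLib

/-!
# CM special pairs MOVED by a rational similitude: the special pair, its reciprocity element and its classes at `q⁻¹ • J`

Topic `AlgebraicGeometry/ModuliOfAbelianVarieties`; namespace `Literature.AlgebraicGeometry.ModuliOfAbelianVarieties`.
THEOREMS ONLY (no definition, no named fact, no instance, no notation, no `sorry`).  Sequel of ★ `SiegelCMSpecialPairConjugate`
(`CMStructure.IsSpecial.exists_conj`, `CMStructure.cmRecipMatrix_eq_conj_of_actMatrix_eq`, `SiegelRationalModel.mk_conjAct_eq_mk_inv_mul`).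
Cell `hodgecm-mathlib` (D-0151), FLOOR 0, P6 «MOD», line L6 (Σ-GAL half of `stub_E6`), organ (K-a) «CM STRUCTURE SPECIAL AT `⟨jOfSiegel (Z a v), _⟩`
VIA THE MOVER» in its GENERIC form: `--supports stmt-HodgeConjecture-24832`, count-neutral; HC_CM is proved only modulo the printed citations
(2 remaining named inputs hLiu418 24832, h413 24833) until rung 0 closes.

WHAT IS PROVED ([Deligne1971TravauxShimura] Déf. 3.13 / 5.1 «si (62) vaut pour `(T, x)` il vaut pour `(qTq⁻¹, qx)`»; [Milne2005ShimuraVarieties]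
Rem. 12.9, Cor. 13.2).  The E-line's MOVER LAW reads `(q a)_ℝ⁻¹ · J(v) · (q a)_ℝ = J(Z a v)` (★ `UnitaryCurve.exists_siegelChartGS_mover` clause (Q),
field `AuxChartGS.q_spec`): the admissible markings of the Σ-AN socket sit at the complex structure `J′ := q⁻¹ • J`, while the CM special pair of
the curve (★ `UnitaryCurve.AuxV.isSpecial_auxComplexStructureV_curve`, ★ `UnitaryCurve.exists_sliceField_siegelRecipDatum`) sits at `J = J(ι₁ w)`.
This file moves every item of the CM reciprocity datum from `J` to `J′` along `q⁻¹ ∈ GSp_δ(ℚ)`: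
* §1 `CMStructure.IsSpecial.exists_inv_conj_of_conjJ_eq` — if `q_ℝ⁻¹ J q_ℝ = J′` then there is a CM structure `c′` on the SAME fields with
  `act′(x) = q⁻¹·act(x)·q`, `(c′, J′)` special with the SAME types, and `c′.cmRecipMatrix Φ E s = q_𝔸⁻¹ · c.cmRecipMatrix Φ E s · q_𝔸` for all `Φ E s`;
* §2 `CMStructure.IsSpecial.exists_inv_conj_recip_of_conjJ_eq` — the same with the reciprocity ELEMENT: for `r ∈ GSp_δ(𝔸_f)` of matrix
  `c.cmRecipMatrix Φ E s`, the element `r′ := q_𝔸⁻¹ r q_𝔸` has matrix `c′.cmRecipMatrix Φ E s` (the `hr` hypothesis shape of ★ `MumfordModuli.CMConjugationIsogenyAll`);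
* §3 `SiegelShimuraSet.mk_eq_mk_inv_mul_of_conjJ_eq` ∕ `mk_inv_conj_mul_inv_mul_eq_of_mk_mul_eq` — the classes: `[J′, q_𝔸⁻¹ a] = [J, a]`, and a class
  identity `[J, r·a₁] = [J, a₂]` moves to `[J′, r′·(q_𝔸⁻¹a₁)] = [J′, q_𝔸⁻¹a₂]`.

## References
* [Deligne1971TravauxShimura] P. Deligne, *Travaux de Shimura*, Sém. Bourbaki 389 (1971): Déf. 3.13 p. 141, 4.18 p. 150, 5.1 p. 153.
* [Milne2005ShimuraVarieties] J. S. Milne, *Introduction to Shimura varieties* (2005): §5 p. 57, Def. 12.8 (60)–(62) p. 114, Rem. 12.9 p. 115,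
  Cor. 13.2 p. 117.
-/

set_option autoImplicit false

noncomputable section

open Matrix NumberField IsDedekindDomain

namespace Literature.AlgebraicGeometry.ModuliOfAbelianVarieties

open Literature.NumberTheory.ComplexMultiplication (traceField)
open Literature.AlgebraicGeometry.Motives (CMType)

variable {g : ℕ} {δ : Fin g → ℕ} {ι : Type} [Fintype ι] [DecidableEq ι] {K : ι → Type} [∀ i, Field (K i)]
  [∀ i, NumberField (K i)] [∀ i, IsCMField (K i)]

namespace CMStructure

/-! ### §1. The special pair and the reciprocity matrix at the moved complex structure `J′ = q_ℝ⁻¹ J q_ℝ` -/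

/-- **THE CM SPECIAL PAIR MOVED BY `q⁻¹`** ([Deligne1971TravauxShimura] Déf. 3.13 ∕ 5.1; [Milne2005ShimuraVarieties] Rem. 12.9): for a special pair
`(c, J)` with types `Φ` and a rational similitude `q ∈ GSp_δ(ℚ)` with `q_ℝ⁻¹ · J · q_ℝ = J′` (the E-line's mover law `AuxChartGS.q_spec`, ★
`UnitaryCurve.exists_siegelChartGS_mover` clause (Q), read in `S^±`), there is a CM structure `c′` on the same fields with `act′(x) = q⁻¹·act(x)·q`,
`(c′, J′)` is a special pair with the same types `Φ`, and the reciprocity elements transform by `r′(s) = q_𝔸⁻¹ · r(s) · q_𝔸` (★ `IsSpecial.exists_conj` and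
★ `cmRecipMatrix_eq_conj_of_actMatrix_eq` at `q⁻¹`). [cite: Deligne1971TravauxShimura, Déf. 3.13 p. 141 and 5.1 p. 153]
[cite: Milne2005ShimuraVarieties, Rem. 12.9 p. 115, Cor. 13.2 p. 117] -/
theorem IsSpecial.exists_inv_conj_of_conjJ_eq (c : CMStructure g δ ι K) {J : C0pm δ} {Φ : ∀ i, CMType (K i)} (hc : c.IsSpecial J Φ)
    (q : gspRational δ) (J' : C0pm δ)
    (hJ' : conjJ (((gspRationalToReal δ q)⁻¹ : ↥(gspReal δ)) : GL (Fin g ⊕ Fin g) ℝ) (J : Matrix (Fin g ⊕ Fin g) (Fin g ⊕ Fin g) ℝ) =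
      (J' : Matrix (Fin g ⊕ Fin g) (Fin g ⊕ Fin g) ℝ)) :
    ∃ c' : CMStructure g δ ι K,
      (∀ x, c'.actMatrix x = (((q : GL (Fin g ⊕ Fin g) ℚ)⁻¹ : GL (Fin g ⊕ Fin g) ℚ) : Matrix (Fin g ⊕ Fin g) (Fin g ⊕ Fin g) ℚ) * c.actMatrix x *
        ((q : GL (Fin g ⊕ Fin g) ℚ) : Matrix (Fin g ⊕ Fin g) (Fin g ⊕ Fin g) ℚ)) ∧
      c'.IsSpecial J' Φ ∧
      ∀ (Φ₁ : ∀ i, CMType (K i)) (E : IntermediateField ℚ ℂ) [NumberField ↥E] (s : (FiniteAdeleRing (𝓞 ↥E) ↥E)ˣ),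
        c'.cmRecipMatrix Φ₁ E s =
          (((gspRationalToFinAdelic δ q : GL (Fin g ⊕ Fin g) finAdeleQ)⁻¹ : GL (Fin g ⊕ Fin g) finAdeleQ) :
              Matrix (Fin g ⊕ Fin g) (Fin g ⊕ Fin g) finAdeleQ) *
            c.cmRecipMatrix Φ₁ E s *
            ((gspRationalToFinAdelic δ q : GL (Fin g ⊕ Fin g) finAdeleQ) : Matrix (Fin g ⊕ Fin g) (Fin g ⊕ Fin g) finAdeleQ) := by
  obtain ⟨c', hact, hsp⟩ := IsSpecial.exists_conj c hc q⁻¹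
  -- the moved complex structure IS `J′`
  have hJ'' : conjAct δ (gspRationalToReal δ q⁻¹) J = J' := by
    apply Subtype.ext
    rw [coe_conjAct, map_inv, hJ']
  refine ⟨c', fun x => ?_, hJ'' ▸ hsp, fun Φ₁ E _ s => ?_⟩
  · rw [hact x, Subgroup.coe_inv, inv_inv]
  · rw [c.cmRecipMatrix_eq_conj_of_actMatrix_eq c' q⁻¹ hact Φ₁ E s, map_inv, Subgroup.coe_inv, inv_inv]

/-! ### §2. The same, with the reciprocity ELEMENT `r′ = q_𝔸⁻¹ r q_𝔸` (the `hr` shape of ★ `CMConjugationIsogenyAll`) -/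

/-- **THE MOVED RECIPROCITY DATUM** — §1 with the reciprocity element as a group element: if `r ∈ GSp_δ(𝔸_f)` has matrix `c.cmRecipMatrix Φ E s`, then
`r′ := q_𝔸⁻¹ · r · q_𝔸` has matrix `c′.cmRecipMatrix Φ E s` for the moved structure `c′` of §1 (so `(c′, J′, Φ, E, σ, s, r′)` is again a datum of the shape
consumed by ★ `MumfordModuli.CMConjugationIsogenyAll` ∕ the reciprocity clause (62) of ★ `SiegelRationalModel.IsCanonical`).
[cite: Deligne1971TravauxShimura, Déf. 3.13 p. 141 and 5.1 p. 153] [cite: Milne2005ShimuraVarieties, Def. 12.8 (60)–(62) p. 114, Rem. 12.9 p. 115] -/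
theorem IsSpecial.exists_inv_conj_recip_of_conjJ_eq (c : CMStructure g δ ι K) {J : C0pm δ} {Φ : ∀ i, CMType (K i)} (hc : c.IsSpecial J Φ)
    (q : gspRational δ) (J' : C0pm δ)
    (hJ' : conjJ (((gspRationalToReal δ q)⁻¹ : ↥(gspReal δ)) : GL (Fin g ⊕ Fin g) ℝ) (J : Matrix (Fin g ⊕ Fin g) (Fin g ⊕ Fin g) ℝ) =
      (J' : Matrix (Fin g ⊕ Fin g) (Fin g ⊕ Fin g) ℝ))
    (E : IntermediateField ℚ ℂ) [NumberField ↥E] (s : (FiniteAdeleRing (𝓞 ↥E) ↥E)ˣ) (r : ↥(gspFinAdelic δ))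
    (hr : ((r : GL (Fin g ⊕ Fin g) finAdeleQ) : Matrix (Fin g ⊕ Fin g) (Fin g ⊕ Fin g) finAdeleQ) = c.cmRecipMatrix Φ E s) :
    ∃ c' : CMStructure g δ ι K,
      (∀ x, c'.actMatrix x = (((q : GL (Fin g ⊕ Fin g) ℚ)⁻¹ : GL (Fin g ⊕ Fin g) ℚ) : Matrix (Fin g ⊕ Fin g) (Fin g ⊕ Fin g) ℚ) * c.actMatrix x *
        ((q : GL (Fin g ⊕ Fin g) ℚ) : Matrix (Fin g ⊕ Fin g) (Fin g ⊕ Fin g) ℚ)) ∧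
      c'.IsSpecial J' Φ ∧
      ((((gspRationalToFinAdelic δ q)⁻¹ * r * gspRationalToFinAdelic δ q : ↥(gspFinAdelic δ)) : GL (Fin g ⊕ Fin g) finAdeleQ) :
          Matrix (Fin g ⊕ Fin g) (Fin g ⊕ Fin g) finAdeleQ) = c'.cmRecipMatrix Φ E s := by
  obtain ⟨c', hact, hsp, hrecip⟩ := IsSpecial.exists_inv_conj_of_conjJ_eq c hc q J' hJ'
  refine ⟨c', hact, hsp, ?_⟩
  rw [hrecip Φ E s, ← hr, Subgroup.coe_mul, Subgroup.coe_mul, Subgroup.coe_inv, Units.val_mul, Units.val_mul]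

end CMStructure

/-! ### §3. The classes in `Sh_K(GSp_δ, S^±)(ℂ)` at the moved complex structure -/

section Classes

variable (K' : Subgroup ↥(gspFinAdelic δ))

/-- `[J′, q_𝔸⁻¹ a K] = [J, a K]` when `q_ℝ⁻¹ J q_ℝ = J′` (★ `SiegelShimuraSet.mk_conjAct_smul` at `q⁻¹`). [cite: Milne2005ShimuraVarieties, §5 p. 57] -/
theorem SiegelShimuraSet.mk_inv_mul_eq_of_conjJ_eq (q : gspRational δ) (J J' : C0pm δ)
    (hJ' : conjJ (((gspRationalToReal δ q)⁻¹ : ↥(gspReal δ)) : GL (Fin g ⊕ Fin g) ℝ) (J : Matrix (Fin g ⊕ Fin g) (Fin g ⊕ Fin g) ℝ) =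
      (J' : Matrix (Fin g ⊕ Fin g) (Fin g ⊕ Fin g) ℝ))
    (a : ↥(gspFinAdelic δ)) :
    SiegelShimuraSet.mk δ K' J' ((gspRationalToFinAdelic δ q)⁻¹ * a) = SiegelShimuraSet.mk δ K' J a := by
  have hJ'' : conjAct δ (gspRationalToReal δ q⁻¹) J = J' := by
    apply Subtype.ext
    rw [coe_conjAct, map_inv, hJ']
  rw [← hJ'', ← map_inv, SiegelShimuraSet.mk_conjAct_smul]

/-- **A CLASS IDENTITY MOVES WITH THE PAIR**: if `[J, r·a₁ K] = [J, a₂ K]` (the reciprocity class identity of ★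
`UnitaryCurve.exists_sliceField_siegelRecipDatum`, `a₁ = ũ(a,1)`, `a₂ = ũ(d′a,1)`), then at `J′ = q_ℝ⁻¹ J q_ℝ` with `r′ = q_𝔸⁻¹ r q_𝔸`:
`[J′, r′·(q_𝔸⁻¹a₁) K] = [J′, q_𝔸⁻¹a₂ K]`. [cite: Milne2005ShimuraVarieties, §5 p. 57 and Rem. 12.9 p. 115] -/
theorem SiegelShimuraSet.mk_inv_conj_mul_inv_mul_eq_of_mk_mul_eq (q : gspRational δ) (J J' : C0pm δ)
    (hJ' : conjJ (((gspRationalToReal δ q)⁻¹ : ↥(gspReal δ)) : GL (Fin g ⊕ Fin g) ℝ) (J : Matrix (Fin g ⊕ Fin g) (Fin g ⊕ Fin g) ℝ) =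
      (J' : Matrix (Fin g ⊕ Fin g) (Fin g ⊕ Fin g) ℝ))
    (r a₁ a₂ : ↥(gspFinAdelic δ)) (h : SiegelShimuraSet.mk δ K' J (r * a₁) = SiegelShimuraSet.mk δ K' J a₂) :
    SiegelShimuraSet.mk δ K' J' ((gspRationalToFinAdelic δ q)⁻¹ * r * gspRationalToFinAdelic δ q * ((gspRationalToFinAdelic δ q)⁻¹ * a₁)) =
      SiegelShimuraSet.mk δ K' J' ((gspRationalToFinAdelic δ q)⁻¹ * a₂) := by
  rw [show (gspRationalToFinAdelic δ q)⁻¹ * r * gspRationalToFinAdelic δ q * ((gspRationalToFinAdelic δ q)⁻¹ * a₁) =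
      (gspRationalToFinAdelic δ q)⁻¹ * (r * a₁) by group,
    SiegelShimuraSet.mk_inv_mul_eq_of_conjJ_eq K' q J J' hJ', SiegelShimuraSet.mk_inv_mul_eq_of_conjJ_eq K' q J J' hJ', h]

end Classes

end Literature.AlgebraicGeometry.ModuliOfAbelianVarieties

end
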